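import Literature.NumberTheory.Rogawski1990.LocalStableClassesNonsplitKappa
import Literature.NumberTheory.Rogawski1990.LocalStableClassesNonsplitTypeOneCount
import Literature.NumberTheory.Rogawski1990.FinExplicitTransferFactorGHRegular
import HarnessLib

/-!
# `κ_v` as a character on the local class set of a type-(1) torus at a non-split place: the four classes split two–two and the
# `κ`-twisted class count vanishes
# (Rogawski 1990, §3.5 Prop. 3.5.2 (c) p. 29, §4.3 (4.3.2) p. 43, §4.9 Prop. 4.9.1 p. 55, §3.6 p. 31)

Topic `NumberTheory/Rogawski1990`; namespace `Literature.NumberTheory.Rogawski1990`.  **THEOREMS ONLY** (no definition, no named fact, no instance,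
no notation, no `sorry`).  Cell `pub/hodgecm-mathlib`, programme P3a, road «D-N7-inert» (inert unit fundamental lemma [Rogawski1990, Prop. 4.9.1 (b)],
map §3 (L4)∕§5 (D5)), brick **(D5)-JUNCTION «κ_H AS A CHARACTER ON THE LOCAL CLASS SET»**: junction of ★ `LocalStableClassesNonsplitTypeOneCount`
(B-p04: the `U(H′)(F_v)`-classes inside the local stable class of a type-(1) element are FOUR, parametrised by the norm tests `T_i(g)` of the eigenvector
lengths) with ★ `LocalStableClassesNonsplitKappa` (F0P3-p02: (4.3.2) — `κ_v(γ_H, g γ′ g⁻¹) = κ_v(γ_H, γ′)` iff `T_{j_H}(g)`).  Seat F0P3-p02 (g11); LEAD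
F0P3a-plan (g9) WORD T8-25 (D).  HONEST LABEL: HC_CM is proved only modulo the printed citations until rung 0 closes; this file is unconditional local algebra.

THE PRINT.  [§3.5 Prop. 3.5.2 (c) p. 29]: `𝓔(T∕F) ≅ {(ε_j) ∈ (ℤ∕2)^r : Σ ε_j = 0}`, of order `2^{r−1}`; type (1) [§3.6]: `r = 3`, four classes; [§4.3 (4.3.2)
p. 43; §4.9 Prop. 4.9.1 p. 55]: on the stable class of `γ′` the transfer factor changes by `κ(inv(γ′, γ″))`, `κ ∈ 𝓡(T∕F)` «the element corresponding to
`H`» — the character `ε ↦ (−1)^{ε_{j_H}}`, NON-TRIVIAL on `𝓔(T∕F_v) ≅ (ℤ∕2)²`.  Hence: its kernel and its complement have two elements each, and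
`Σ_{c ⊂ 𝒪_st(γ′)} κ_v(γ_H, c) = 0` — the orthogonality that kills the `κ`-orbital sum of any function constant on the stable class.

WHAT IS PROVED (CM carriers of ★ `finKappaAt` as in ★ `LocalStableClassesNonsplitKappa`: `L` CM, `v` finite place of `L⁺` NON-SPLIT in `L` (`c • w = w`),
`H′ ∈ M₃(L)`, `γ_H = a`, `γ′ = b ∈ G′_v = (cmDatum L 3 H′).Local v`; classes `c : ConjClasses U(H′_v)(F_v)` inside ★ `conjClassesIn σ H′_v ⟨b, _⟩` (the ★ `unitaryGroup` carrier of ★ 2b; `G′_v` is the same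
group in ★ `cmDatum` clothing — the two ★ subgroups have the same carrier, so `⟨δ.val, δ.2⟩` moves elements either way by `rfl`); `κ` read on any
representative `δ` of `c` (it is a class function) or at `Quotient.out c`, as under `∑ᶠ c, Δ(γ_H, out c) · Φ(c, f)` in ★ `IsLocalDeltaTransfer`).
ELABORATION NOTE (for editors): every syntactic occurrence of `unitaryGroup (conjLocal E c v) H` costs ≈ 1 s of instance search, so the statements
mention it once or twice and let unification propagate it; the long proof abstracts it with `set` after reverting the `κ`-hypotheses.
* §1 `κ_v(γ_H, ·)` is a CLASS FUNCTION (`finKappaAt_eq_of_isConj`, ★ `finKappaAt_conj_right`), `κ_v(γ_H, out ⟦γ′⟧) = κ_v(γ_H, γ′)`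
  (`finKappaAt_out_mk`), and it descends to the classes of `U(H′_v)(F_v)` (`finKappaAt_eq_of_mk_eq_mk`).
* §2 GENERIC (E∕F-generic binders of ★ 2b; an abstract sign `κ : U(H)(F_v) → ℤ` which is a class function, takes the values `±1` on the stable class
  and obeys the (4.3.2) flip rule at the frame index `j`): the local class set of a type-(1) element is `{⟦γ₀⟧, ⟦γ_j⟧, ⟦γ_k⟧, ⟦γ_l⟧}` with
  `γ_m = g_m γ g_m⁻¹` realising the sign vector «tests pass exactly at `m`» (★ `exists_conj_mem_forall_normTest_iff`) and `γ₀` all tests passing;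
  `κ` keeps the sign of `γ` on `⟦γ₀⟧, ⟦γ_j⟧` and flips it on `⟦γ_k⟧, ⟦γ_l⟧` (`{k, l} = {0,1,2} ∖ {j}`): `exists_conjClassesIn_eq_four_sign`,
  `ncard_conjClassesIn_sep_sign_eq_eq_two`, `ncard_conjClassesIn_sep_sign_eq_neg_two`, `finsum_mem_conjClassesIn_sign_out_eq_zero`.
* §3 CM (`κ := κ_v(γ_H, ·)` = ★ `finKappaAt`, its three hypotheses discharged by §1, ★ `finKappaAt_conj_eq_iff_normTest` (p840169) and ★
  `finKappaAt_eq_one_or_eq_neg_one_of_isUnit`): **`ncard_conjClassesIn_sep_finKappaAt_eq_eq_two`** (`|{c : κ_v(γ_H, c) = κ_v(γ_H, γ′)}| = 2`),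
  **`ncard_conjClassesIn_sep_finKappaAt_eq_neg_two`** (`= −κ_v(γ_H, γ′)`: also `2`), **`finsum_mem_conjClassesIn_finKappaAt_out_eq_zero`** (`Σ_c κ_v(γ_H, out c) = 0`).
Type (2) («1 + 1») is the sibling over B-p14's 2b-IV count; §2 is torus-type-free in its `κ` hypotheses.

## References
* [Rogawski1990] J. D. Rogawski, *Automorphic Representations of Unitary Groups in Three Variables*, Ann. of Math. Stud. 123 (1990), §3.1 p. 19,
  §3.5 Prop. 3.5.2 (c) p. 29, §3.6 p. 31, §4.3 (4.3.2) p. 43, §4.9 Prop. 4.9.1 p. 55, §14.6 p. 242.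
* [LanglandsShelstad1987] R. P. Langlands, D. Shelstad, *On the definition of transfer factors*, Math. Ann. 278 (1987), §1.
* [Kottwitz1986] R. E. Kottwitz, *Stable trace formula: elliptic singular terms*, Math. Ann. 275 (1986), §7.
-/

set_option autoImplicit false

noncomputable section

open NumberField IsDedekindDomain Matrix
open scoped MatrixGroups

namespace Literature.NumberTheory.Rogawski1990

open Literature.NumberTheory.Automorphic Literature.NumberTheory.Automorphic.UnitaryGroup
open Literature.AlgebraicGeometry.ShimuraVarieties (unitaryGroup)

/-! ## §0 Bookkeeping -/

section Prelim

/-- A CM field has a non-zero element negated by complex conjugation (`ζ − ζ̄` for any `ζ` moved by `c ≠ 1`). [cite: Rogawski1990, §1.10] -/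
private theorem exists_complexConj_eq_neg_ne_zero (L : Type) [Field L] [NumberField L] [IsCMField L] :
    ∃ δ : L, IsCMField.complexConj L δ = -δ ∧ δ ≠ 0 := by
  obtain ⟨ζ, hζ⟩ := not_forall.1 fun h0 => IsCMField.complexConj_ne_one L (AlgEquiv.ext h0)
  refine ⟨ζ - IsCMField.complexConj L ζ, by rw [map_sub, IsCMField.complexConj_apply_apply, neg_sub], fun h0 => hζ ?_⟩
  rw [sub_eq_zero] at h0
  exact h0.symm

/-- `⟦out c⟧ = c` for conjugacy classes. [folklore] -/
private theorem mk_out_eq {G : Type*} [Monoid G] (c : ConjClasses G) : ConjClasses.mk (Quotient.out c) = c := by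
  rw [← ConjClasses.quotient_mk_eq_mk]
  exact Quotient.out_eq c

/-- Two distinct indices avoid a given one in `Fin 3`. [folklore] -/
private theorem exists_ne_ne_ne (j : Fin 3) : ∃ k l : Fin 3, k ≠ j ∧ l ≠ j ∧ k ≠ l := by
  revert j; decide

/-- The sign vector «zero exactly at `m`» sums to zero in `(ℤ∕2)³`. [folklore] -/
private theorem sum_ite_eq_zero (m : Fin 3) : ∑ i : Fin 3, (if i = m then (0 : ZMod 2) else 1) = 0 := by
  revert m; decide

/-- `(if i = m then 0 else 1) = 0 ↔ i = m` in `ℤ∕2`. [folklore] -/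
private theorem ite_eq_zero_iff (i m : Fin 3) : (if i = m then (0 : ZMod 2) else 1) = 0 ↔ i = m := by
  by_cases h : i = m
  · simp only [h, if_true]
  · simp only [h, if_false, iff_false]; decide

/-- Two signs that differ are opposite. [folklore] -/
private theorem eq_neg_of_ne_of_sign {x y : ℤ} (hx : x = 1 ∨ x = -1) (hy : y = 1 ∨ y = -1) (h : x ≠ y) : x = -y := by
  rcases hx with rfl | rfl <;> rcases hy with rfl | rfl <;> simp_all

/-- Four pairwise distinct elements form a set of cardinal four. [folklore] -/
private theorem ncard_four {α : Type*} {c₀ c₁ c₂ c₃ : α} (h01 : c₀ ≠ c₁) (h02 : c₀ ≠ c₂) (h03 : c₀ ≠ c₃) (h12 : c₁ ≠ c₂) (h13 : c₁ ≠ c₃)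
    (h23 : c₂ ≠ c₃) : ({c₀, c₁, c₂, c₃} : Set α).ncard = 4 := by
  rw [Set.ncard_insert_of_notMem (by simp [h01, h02, h03]), Set.ncard_insert_of_notMem (by simp [h12, h13]), Set.ncard_pair h23]

end Prelim

/-! ## §1 `κ_v(γ_H, ·)` is a class function -/

section ClassFunction

variable (L : Type) [Field L] [NumberField L] [IsCMField L] (v : HeightOneSpectrum (𝓞 ↥(maximalRealSubfield L)))
  (H' : Matrix (Fin 3) (Fin 3) L)
  (a : (UnitaryGroup.cmDatum L 2 (Matrix.of fun i j : Fin 2 => if i.val + j.val + 1 = 2 then (1 : L) else 0)).Local v ×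
      (UnitaryGroup.cmDatum L 1 (Matrix.of fun i j : Fin 1 => if i.val + j.val + 1 = 1 then (1 : L) else 0)).Local v)
  (b : (UnitaryGroup.cmDatum L 3 H').Local v)

/-- **`κ_v(γ_H, ·)` IS A CLASS FUNCTION ON `G′_v`**: if `γ′ ↔ ι_v(γ_H)` and `γ″` is `G′_v`-conjugate to `γ′` then `κ_v(γ_H, γ″) = κ_v(γ_H, γ′)`
(★ `finKappaAt_conj_right` in `IsConj` currency). [cite: Rogawski1990, §4.3 p. 43; §14.6 p. 242] -/
theorem finKappaAt_eq_of_isConj (h : IsLocalNormPair L H' v a b) {b' : (UnitaryGroup.cmDatum L 3 H').Local v} (hc : IsConj b b') :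
    finKappaAt L v H' a b' = finKappaAt L v H' a b := by
  obtain ⟨y, hy⟩ := isConj_iff.1 hc
  rw [← hy]
  exact finKappaAt_conj_right L v H' a b y h

/-- **`κ_v(γ_H, ·)` on a conjugacy CLASS of `G′_v`**: for the class `⟦γ′⟧` of a match `γ′`, the value at the chosen representative `Quotient.out ⟦γ′⟧` is
`κ_v(γ_H, γ′)` — the reading used under `∑ᶠ c : ConjClasses G′_v, Δ(γ_H, out c) · Φ(c, f)` (★ `IsLocalDeltaTransfer`). [cite: Rogawski1990, §4.3 p. 43] -/
theorem finKappaAt_out_mk (h : IsLocalNormPair L H' v a b) :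
    finKappaAt L v H' a (Quotient.out (ConjClasses.mk b)) = finKappaAt L v H' a b :=
  finKappaAt_eq_of_isConj L v H' a b h (ConjClasses.mk_eq_mk_iff_isConj.1 (mk_out_eq (ConjClasses.mk b)).symm)

/-- **`κ_v(γ_H, ·)` descends to the classes of `U(H′_v)(F_v)`** (the ★ `unitaryGroup` carrier of ★ `conjClassesIn`; `G′_v` is the same group in ★
`cmDatum` clothing): for `δ, δ′ ∈ U(H′_v)(F_v)` with `⟦δ⟧ = ⟦δ′⟧` and `δ ↔ ι_v(γ_H)`, `κ_v(γ_H, δ′) = κ_v(γ_H, δ)`. [cite: Rogawski1990, §4.3 p. 43] -/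
theorem finKappaAt_eq_of_mk_eq_mk {δ δ' : ↥(unitaryGroup (UnitaryGroup.conjLocal L (IsCMField.complexConj L) v)
        ((UnitaryGroup.adelicForm L 3 H').map (UnitaryGroup.adeleToLocal L v)))}
    (h : IsLocalNormPair L H' v a (⟨δ.val, δ.2⟩ : (UnitaryGroup.cmDatum L 3 H').Local v)) (hmk : ConjClasses.mk δ = ConjClasses.mk δ') :
    finKappaAt L v H' a (⟨δ'.val, δ'.2⟩ : (UnitaryGroup.cmDatum L 3 H').Local v) = finKappaAt L v H' a (⟨δ.val, δ.2⟩ : (UnitaryGroup.cmDatum L 3 H').Local v) := by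
  obtain ⟨y, hy⟩ := isConj_iff.1 (ConjClasses.mk_eq_mk_iff_isConj.1 hmk)
  refine finKappaAt_eq_of_isConj L v H' a _ h (isConj_iff.2 ⟨⟨y.val, y.2⟩, Subtype.ext ?_⟩)
  exact congrArg Subtype.val hy

end ClassFunction



/-! ## §2 Generic: a class function with the (4.3.2) flip rule splits the type-(1) class set two–two (E∕F-generic currency of ★ 2b) -/

section Generic

variable {F : Type} (E : Type) [Field F] [NumberField F] [Field E] [NumberField E] [Algebra F E]
  [Algebra.IsQuadraticExtension F E] (v : HeightOneSpectrum (𝓞 F)) (c : E ≃ₐ[F] E) {δ : E} (hcδ : c δ = -δ) (hδ : δ ≠ 0)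

variable {H : Matrix (Fin 3) (Fin 3) (LocalRing E v)} {γ P : GL (Fin 3) (LocalRing E v)} {u : Fin 3 → LocalRing E v}

include hcδ hδ in
/-- **Classes are separated by the norm tests** (★ `exists_unitary_conj_iff_forall_normTest_iff` read on `ConjClasses`): equal classes
`⟦g₁ γ g₁⁻¹⟧ = ⟦g₂ γ g₂⁻¹⟧` in `U = U(H)(F_v)` have the same norm tests.  [cite: Rogawski1990, §3.5 Prop. 3.5.2 (a)(c) p. 29] -/
theorem forall_normTest_iff_of_mk_eq_mk (w : PlacesOver E v) (hw : c • w.1 = w.1)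
    (hH : (H.map (conjLocal E c v))ᵀ = H) (hHd : IsUnit H.det) (hγ : γ ∈ unitaryGroup (conjLocal E c v) H)
    (hP : γ.val * P.val = P.val * diagonal u) (hu : Function.Injective u) (hu1 : ∀ i, conjLocal E c v (u i) * u i = 1)
    {g₁ g₂ : GL (Fin 3) (LocalRing E v)} {h₁ h₂}
    (hmk : ConjClasses.mk (⟨g₁ * γ * g₁⁻¹, h₁⟩ : ↥(unitaryGroup (conjLocal E c v) H)) = ConjClasses.mk ⟨g₂ * γ * g₂⁻¹, h₂⟩) (i : Fin 3) :
    (∃ z : LocalRing E v, IsUnit z ∧ twistGram (conjLocal E c v) H (g₂.val * P.val) i i =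
            conjLocal E c v z * z * twistGram (conjLocal E c v) H P.val i i) ↔
      (∃ z : LocalRing E v, IsUnit z ∧ twistGram (conjLocal E c v) H (g₁.val * P.val) i i =
            conjLocal E c v z * z * twistGram (conjLocal E c v) H P.val i i) := by
  rw [ConjClasses.mk_eq_mk_iff_isConj, isConj_iff] at hmk
  obtain ⟨y, hy⟩ := hmk
  have hconj : ∃ w', w' ∈ unitaryGroup (conjLocal E c v) H ∧ w' * (g₁ * γ * g₁⁻¹) * w'⁻¹ = g₂ * γ * g₂⁻¹ :=
    ⟨y.val, y.2, congrArg Subtype.val hy⟩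
  rw [exists_unitary_conj_iff_forall_normTest_iff E v c hcδ hδ w hw hH hHd hγ hP hu hu1 h₁ h₂] at hconj
  exact hconj i

include hcδ hδ in
/-- **THE FOUR CLASSES AND THEIR SIGNS** (type (1), non-split `v`): for a sign `κ : U(H)(F_v) → ℤ` which is a class function with values `±1` on the stable class of `γ`,
obeying the (4.3.2) flip rule «`κ(g γ g⁻¹) = κ(γ)` iff the norm test `T_j(g)` passes» at the frame index `j`, the local class set of `γ` consists of FOUR
pairwise distinct classes `⟦γ₀⟧, ⟦γ₁⟧, ⟦γ₂⟧, ⟦γ₃⟧` with `κ = κ(γ)` on the first two and `κ = −κ(γ)` on the last two.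
[cite: Rogawski1990, §3.5 Prop. 3.5.2 (c) p. 29; §4.3 (4.3.2) p. 43; §4.9 Prop. 4.9.1 p. 55] -/
theorem exists_conjClassesIn_eq_four_sign (w : PlacesOver E v) (hw : c • w.1 = w.1)
    (hH : (H.map (conjLocal E c v))ᵀ = H) (hHd : IsUnit H.det) (hγ : γ ∈ unitaryGroup (conjLocal E c v) H)
    (hP : γ.val * P.val = P.val * diagonal u) (hu : Function.Injective u) (hu1 : ∀ i, conjLocal E c v (u i) * u i = 1)
    (j : Fin 3) {κ : ↥(unitaryGroup (conjLocal E c v) H) → ℤ}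
    (hκc : ∀ (g : GL (Fin 3) (LocalRing E v)) (hg) (y), ConjClasses.mk ⟨g * γ * g⁻¹, hg⟩ = ConjClasses.mk y → κ y = κ ⟨g * γ * g⁻¹, hg⟩)
    (hκs : ∀ (g : GL (Fin 3) (LocalRing E v)) (hg), κ ⟨g * γ * g⁻¹, hg⟩ = 1 ∨ κ ⟨g * γ * g⁻¹, hg⟩ = -1)
    (hκγ : κ ⟨γ, hγ⟩ = 1 ∨ κ ⟨γ, hγ⟩ = -1)
    (hκj : ∀ (g : GL (Fin 3) (LocalRing E v)) (hg),
      κ ⟨g * γ * g⁻¹, hg⟩ = κ ⟨γ, hγ⟩ ↔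
        ∃ z : LocalRing E v, IsUnit z ∧ twistGram (conjLocal E c v) H (g.val * P.val) j j =
          conjLocal E c v z * z * twistGram (conjLocal E c v) H P.val j j) :
    ∃ c₀ c₁ c₂ c₃,
      conjClassesIn (conjLocal E c v) H ⟨γ, hγ⟩ = {c₀, c₁, c₂, c₃} ∧
        c₀ ≠ c₁ ∧ c₀ ≠ c₂ ∧ c₀ ≠ c₃ ∧ c₁ ≠ c₂ ∧ c₁ ≠ c₃ ∧ c₂ ≠ c₃ ∧
        (∀ δ, ConjClasses.mk δ = c₀ → κ δ = κ ⟨γ, hγ⟩) ∧ (∀ δ, ConjClasses.mk δ = c₁ → κ δ = κ ⟨γ, hγ⟩) ∧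
        (∀ δ, ConjClasses.mk δ = c₂ → κ δ = -κ ⟨γ, hγ⟩) ∧ (∀ δ, ConjClasses.mk δ = c₃ → κ δ = -κ ⟨γ, hγ⟩) := by
  classical
  -- abstract the unitary group ONCE (each syntactic occurrence of `unitaryGroup (conjLocal E c v) H` costs ≈ 1 s of instance search)
  revert κ
  set U := unitaryGroup (conjLocal E c v) H with hU
  intro κ hκc hκs hκγ hκj
  -- the norm tests of a stable conjugator
  set T : GL (Fin 3) (LocalRing E v) → Fin 3 → Prop := fun g i =>
    ∃ z : LocalRing E v, IsUnit z ∧ twistGram (conjLocal E c v) H (g.val * P.val) i i =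
      conjLocal E c v z * z * twistGram (conjLocal E c v) H P.val i i with hT
  -- the realised conjugates `γ_m = g_m γ g_m⁻¹`, `m : Fin 3`, with norm tests «pass exactly at `m`», and `γ₀` with all tests passing
  have hreal : ∀ m : Fin 3, ∃ g : GL (Fin 3) (LocalRing E v), g * γ * g⁻¹ ∈ U ∧ ∀ i, (T g i ↔ (if i = m then (0 : ZMod 2) else 1) = 0) :=
    fun m => exists_conj_mem_forall_normTest_iff E v c hcδ hδ w hw hH hHd hγ hP hu hu1 _ (sum_ite_eq_zero m)
  choose g hgU hTg using hreal
  have hT' : ∀ m i, (T (g m) i ↔ i = m) := fun m i => (hTg m i).trans (ite_eq_zero_iff i m)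
  obtain ⟨g₀, hg₀U, hT₀⟩ : ∃ g : GL (Fin 3) (LocalRing E v), g * γ * g⁻¹ ∈ U ∧ ∀ i, (T g i ↔ (0 : ZMod 2) = 0) :=
    exists_conj_mem_forall_normTest_iff E v c hcδ hδ w hw hH hHd hγ hP hu hu1 (fun _ => (0 : ZMod 2))
      (by simp only [Finset.sum_const_zero])
  have hT₀' : ∀ i, T g₀ i := fun i => (hT₀ i).2 rfl
  -- classes are separated by the norm tests
  have sep : ∀ {g₁ g₂ : GL (Fin 3) (LocalRing E v)} (h₁ : g₁ * γ * g₁⁻¹ ∈ U) (h₂ : g₂ * γ * g₂⁻¹ ∈ U),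
      ConjClasses.mk (⟨g₁ * γ * g₁⁻¹, h₁⟩ : ↥U) = ConjClasses.mk ⟨g₂ * γ * g₂⁻¹, h₂⟩ → ∀ i, (T g₂ i ↔ T g₁ i) :=
    fun h₁ h₂ hmk i => forall_normTest_iff_of_mk_eq_mk E v c hcδ hδ w hw hH hHd hγ hP hu hu1 hmk i
  -- distinctness
  have h0m : ∀ m, ConjClasses.mk (⟨g₀ * γ * g₀⁻¹, hg₀U⟩ : ↥U) ≠ ConjClasses.mk ⟨g m * γ * (g m)⁻¹, hgU m⟩ := by
    intro m h0
    obtain ⟨k, l, hk, -, -⟩ := exists_ne_ne_ne m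
    exact hk ((hT' m k).1 ((sep hg₀U (hgU m) h0 k).2 (hT₀' k)))
  have hmm : ∀ m m', m ≠ m' → ConjClasses.mk (⟨g m * γ * (g m)⁻¹, hgU m⟩ : ↥U) ≠ ConjClasses.mk ⟨g m' * γ * (g m')⁻¹, hgU m'⟩ := by
    intro m m' hne h0
    have h2 := sep (hgU m) (hgU m') h0 m
    rw [hT' m' m, hT' m m] at h2
    exact hne (h2.2 rfl)
  -- the class set is these four
  obtain ⟨k, l, hkj, hlj, hkl⟩ := exists_ne_ne_ne j
  have hS4 : (conjClassesIn (conjLocal E c v) H ⟨γ, hγ⟩).ncard = 4 := ncard_conjClassesIn_eq_four E v c hcδ hδ w hw hH hHd hγ hP hu hu1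
  have hSfin : (conjClassesIn (conjLocal E c v) H ⟨γ, hγ⟩).Finite := finite_conjClassesIn_of_eigenframe E v c hcδ hδ w hw hH hHd hγ hP hu hu1
  have hmem : ∀ (g' : GL (Fin 3) (LocalRing E v)) (hg' : g' * γ * g'⁻¹ ∈ U),
      ConjClasses.mk (⟨g' * γ * g'⁻¹, hg'⟩ : ↥U) ∈ conjClassesIn (conjLocal E c v) H ⟨γ, hγ⟩ :=
    fun g' hg' => mk_mem_conjClassesIn_iff.2 (isStablyConj_iff.2 ⟨g', rfl⟩)
  have hsub : ({ConjClasses.mk (⟨g₀ * γ * g₀⁻¹, hg₀U⟩ : ↥U), ConjClasses.mk ⟨g j * γ * (g j)⁻¹, hgU j⟩,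
      ConjClasses.mk ⟨g k * γ * (g k)⁻¹, hgU k⟩, ConjClasses.mk ⟨g l * γ * (g l)⁻¹, hgU l⟩} : Set (ConjClasses ↥U)) ⊆ conjClassesIn (conjLocal E c v) H ⟨γ, hγ⟩ := by
    intro x hx
    simp only [Set.mem_insert_iff, Set.mem_singleton_iff] at hx
    rcases hx with rfl | rfl | rfl | rfl
    · exact hmem g₀ hg₀U
    · exact hmem (g j) (hgU j)
    · exact hmem (g k) (hgU k)
    · exact hmem (g l) (hgU l)
  have h4 : ({ConjClasses.mk (⟨g₀ * γ * g₀⁻¹, hg₀U⟩ : ↥U), ConjClasses.mk ⟨g j * γ * (g j)⁻¹, hgU j⟩,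
      ConjClasses.mk ⟨g k * γ * (g k)⁻¹, hgU k⟩, ConjClasses.mk ⟨g l * γ * (g l)⁻¹, hgU l⟩} : Set (ConjClasses ↥U)).ncard = 4 :=
    ncard_four (h0m j) (h0m k) (h0m l) (hmm j k hkj.symm) (hmm j l hlj.symm) (hmm k l hkl)
  have heq := Set.eq_of_subset_of_ncard_le hsub (by rw [hS4, h4]) hSfin
  -- the signs at the realised representatives
  have hκ₀ : κ ⟨g₀ * γ * g₀⁻¹, hg₀U⟩ = κ ⟨γ, hγ⟩ := (hκj g₀ hg₀U).2 (hT₀' j)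
  have hκiff : ∀ m, κ ⟨g m * γ * (g m)⁻¹, hgU m⟩ = κ ⟨γ, hγ⟩ ↔ m = j := fun m => (hκj (g m) (hgU m)).trans ((hT' m j).trans eq_comm)
  have hκk : κ ⟨g k * γ * (g k)⁻¹, hgU k⟩ = -κ ⟨γ, hγ⟩ := eq_neg_of_ne_of_sign (hκs (g k) (hgU k)) hκγ (fun h0 => hkj ((hκiff k).1 h0))
  have hκl : κ ⟨g l * γ * (g l)⁻¹, hgU l⟩ = -κ ⟨γ, hγ⟩ := eq_neg_of_ne_of_sign (hκs (g l) (hgU l)) hκγ (fun h0 => hlj ((hκiff l).1 h0))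
  refine ⟨ConjClasses.mk ⟨g₀ * γ * g₀⁻¹, hg₀U⟩, ConjClasses.mk ⟨g j * γ * (g j)⁻¹, hgU j⟩, ConjClasses.mk ⟨g k * γ * (g k)⁻¹, hgU k⟩,
    ConjClasses.mk ⟨g l * γ * (g l)⁻¹, hgU l⟩, heq.symm, h0m j, h0m k, h0m l, hmm j k hkj.symm, hmm j l hlj.symm, hmm k l hkl,
    fun δ' hmk => (hκc _ _ _ hmk.symm).trans hκ₀, fun δ' hmk => (hκc _ _ _ hmk.symm).trans ((hκiff j).2 rfl),
    fun δ' hmk => (hκc _ _ _ hmk.symm).trans hκk, fun δ' hmk => (hκc _ _ _ hmk.symm).trans hκl⟩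

include hcδ hδ in
/-- **The kernel half: exactly two of the four classes carry the sign of `γ`.** [cite: Rogawski1990, §3.5 Prop. 3.5.2 (c) p. 29; §4.3 (4.3.2) p. 43] -/
theorem ncard_conjClassesIn_sep_sign_eq_eq_two (w : PlacesOver E v) (hw : c • w.1 = w.1)
    (hH : (H.map (conjLocal E c v))ᵀ = H) (hHd : IsUnit H.det) (hγ : γ ∈ unitaryGroup (conjLocal E c v) H)
    (hP : γ.val * P.val = P.val * diagonal u) (hu : Function.Injective u) (hu1 : ∀ i, conjLocal E c v (u i) * u i = 1)
    (j : Fin 3) {κ : ↥(unitaryGroup (conjLocal E c v) H) → ℤ}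
    (hκc : ∀ (g : GL (Fin 3) (LocalRing E v)) (hg) (y), ConjClasses.mk ⟨g * γ * g⁻¹, hg⟩ = ConjClasses.mk y → κ y = κ ⟨g * γ * g⁻¹, hg⟩)
    (hκs : ∀ (g : GL (Fin 3) (LocalRing E v)) (hg), κ ⟨g * γ * g⁻¹, hg⟩ = 1 ∨ κ ⟨g * γ * g⁻¹, hg⟩ = -1)
    (hκγ : κ ⟨γ, hγ⟩ = 1 ∨ κ ⟨γ, hγ⟩ = -1)
    (hκj : ∀ (g : GL (Fin 3) (LocalRing E v)) (hg),
      κ ⟨g * γ * g⁻¹, hg⟩ = κ ⟨γ, hγ⟩ ↔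
        ∃ z : LocalRing E v, IsUnit z ∧ twistGram (conjLocal E c v) H (g.val * P.val) j j =
          conjLocal E c v z * z * twistGram (conjLocal E c v) H P.val j j) :
    {x ∈ conjClassesIn (conjLocal E c v) H ⟨γ, hγ⟩ | ∀ δ, ConjClasses.mk δ = x → κ δ = κ ⟨γ, hγ⟩}.ncard = 2 := by
  obtain ⟨c₀, c₁, c₂, c₃, hS, h01, h02, h03, h12, h13, h23, hκ₀, hκ₁, hκ₂, hκ₃⟩ :=
    exists_conjClassesIn_eq_four_sign E v c hcδ hδ w hw hH hHd hγ hP hu hu1 j hκc hκs hκγ hκj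
  have hne : -κ ⟨γ, hγ⟩ ≠ κ ⟨γ, hγ⟩ := by rcases hκγ with h1 | h1 <;> rw [h1] <;> decide
  have hset : {x ∈ conjClassesIn (conjLocal E c v) H ⟨γ, hγ⟩ | ∀ δ, ConjClasses.mk δ = x → κ δ = κ ⟨γ, hγ⟩} = {c₀, c₁} := by
    ext x
    simp only [hS, Set.mem_insert_iff, Set.mem_singleton_iff, Set.mem_setOf_eq]
    constructor
    · rintro ⟨hx | hx | hx | hx, hκ⟩
      · exact Or.inl hx
      · exact Or.inr hx
      · exact absurd ((hκ₂ _ (hx ▸ mk_out_eq x)).symm.trans (hκ _ (mk_out_eq x))) hne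
      · exact absurd ((hκ₃ _ (hx ▸ mk_out_eq x)).symm.trans (hκ _ (mk_out_eq x))) hne
    · rintro (rfl | rfl)
      · exact ⟨Or.inl rfl, hκ₀⟩
      · exact ⟨Or.inr (Or.inl rfl), hκ₁⟩
  rw [hset, Set.ncard_pair h01]

include hcδ hδ in
/-- **The other half: exactly two of the four classes carry the opposite sign.** [cite: Rogawski1990, §3.5 Prop. 3.5.2 (c) p. 29; §4.3 (4.3.2) p. 43] -/
theorem ncard_conjClassesIn_sep_sign_eq_neg_two (w : PlacesOver E v) (hw : c • w.1 = w.1)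
    (hH : (H.map (conjLocal E c v))ᵀ = H) (hHd : IsUnit H.det) (hγ : γ ∈ unitaryGroup (conjLocal E c v) H)
    (hP : γ.val * P.val = P.val * diagonal u) (hu : Function.Injective u) (hu1 : ∀ i, conjLocal E c v (u i) * u i = 1)
    (j : Fin 3) {κ : ↥(unitaryGroup (conjLocal E c v) H) → ℤ}
    (hκc : ∀ (g : GL (Fin 3) (LocalRing E v)) (hg) (y), ConjClasses.mk ⟨g * γ * g⁻¹, hg⟩ = ConjClasses.mk y → κ y = κ ⟨g * γ * g⁻¹, hg⟩)
    (hκs : ∀ (g : GL (Fin 3) (LocalRing E v)) (hg), κ ⟨g * γ * g⁻¹, hg⟩ = 1 ∨ κ ⟨g * γ * g⁻¹, hg⟩ = -1)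
    (hκγ : κ ⟨γ, hγ⟩ = 1 ∨ κ ⟨γ, hγ⟩ = -1)
    (hκj : ∀ (g : GL (Fin 3) (LocalRing E v)) (hg),
      κ ⟨g * γ * g⁻¹, hg⟩ = κ ⟨γ, hγ⟩ ↔
        ∃ z : LocalRing E v, IsUnit z ∧ twistGram (conjLocal E c v) H (g.val * P.val) j j =
          conjLocal E c v z * z * twistGram (conjLocal E c v) H P.val j j) :
    {x ∈ conjClassesIn (conjLocal E c v) H ⟨γ, hγ⟩ | ∀ δ, ConjClasses.mk δ = x → κ δ = -κ ⟨γ, hγ⟩}.ncard = 2 := by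
  obtain ⟨c₀, c₁, c₂, c₃, hS, h01, h02, h03, h12, h13, h23, hκ₀, hκ₁, hκ₂, hκ₃⟩ :=
    exists_conjClassesIn_eq_four_sign E v c hcδ hδ w hw hH hHd hγ hP hu hu1 j hκc hκs hκγ hκj
  have hne : κ ⟨γ, hγ⟩ ≠ -κ ⟨γ, hγ⟩ := by rcases hκγ with h1 | h1 <;> rw [h1] <;> decide
  have hset : {x ∈ conjClassesIn (conjLocal E c v) H ⟨γ, hγ⟩ | ∀ δ, ConjClasses.mk δ = x → κ δ = -κ ⟨γ, hγ⟩} = {c₂, c₃} := by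
    ext x
    simp only [hS, Set.mem_insert_iff, Set.mem_singleton_iff, Set.mem_setOf_eq]
    constructor
    · rintro ⟨hx | hx | hx | hx, hκ⟩
      · exact absurd ((hκ₀ _ (hx ▸ mk_out_eq x)).symm.trans (hκ _ (mk_out_eq x))) hne
      · exact absurd ((hκ₁ _ (hx ▸ mk_out_eq x)).symm.trans (hκ _ (mk_out_eq x))) hne
      · exact Or.inl hx
      · exact Or.inr hx
    · rintro (rfl | rfl)
      · exact ⟨Or.inr (Or.inr (Or.inl rfl)), hκ₂⟩
      · exact ⟨Or.inr (Or.inr (Or.inr rfl)), hκ₃⟩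
  rw [hset, Set.ncard_pair h23]

include hcδ hδ in
/-- **The `κ`-twisted count vanishes**: `Σ_{x ⊂ 𝒪_st(γ)} κ(out x) = 0` — a non-trivial character of `𝓔(T∕F_v) ≅ (ℤ∕2)²` sums to zero.
[cite: Rogawski1990, §3.5 Prop. 3.5.2 (c) p. 29; §4.3 (4.3.2) p. 43; §4.9 Prop. 4.9.1 p. 55] -/
theorem finsum_mem_conjClassesIn_sign_out_eq_zero (w : PlacesOver E v) (hw : c • w.1 = w.1)
    (hH : (H.map (conjLocal E c v))ᵀ = H) (hHd : IsUnit H.det) (hγ : γ ∈ unitaryGroup (conjLocal E c v) H)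
    (hP : γ.val * P.val = P.val * diagonal u) (hu : Function.Injective u) (hu1 : ∀ i, conjLocal E c v (u i) * u i = 1)
    (j : Fin 3) {κ : ↥(unitaryGroup (conjLocal E c v) H) → ℤ}
    (hκc : ∀ (g : GL (Fin 3) (LocalRing E v)) (hg) (y), ConjClasses.mk ⟨g * γ * g⁻¹, hg⟩ = ConjClasses.mk y → κ y = κ ⟨g * γ * g⁻¹, hg⟩)
    (hκs : ∀ (g : GL (Fin 3) (LocalRing E v)) (hg), κ ⟨g * γ * g⁻¹, hg⟩ = 1 ∨ κ ⟨g * γ * g⁻¹, hg⟩ = -1)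
    (hκγ : κ ⟨γ, hγ⟩ = 1 ∨ κ ⟨γ, hγ⟩ = -1)
    (hκj : ∀ (g : GL (Fin 3) (LocalRing E v)) (hg),
      κ ⟨g * γ * g⁻¹, hg⟩ = κ ⟨γ, hγ⟩ ↔
        ∃ z : LocalRing E v, IsUnit z ∧ twistGram (conjLocal E c v) H (g.val * P.val) j j =
          conjLocal E c v z * z * twistGram (conjLocal E c v) H P.val j j) :
    ∑ᶠ x ∈ conjClassesIn (conjLocal E c v) H ⟨γ, hγ⟩, κ (Quotient.out x) = 0 := by
  obtain ⟨c₀, c₁, c₂, c₃, hS, h01, h02, h03, h12, h13, h23, hκ₀, hκ₁, hκ₂, hκ₃⟩ :=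
    exists_conjClassesIn_eq_four_sign E v c hcδ hδ w hw hH hHd hγ hP hu hu1 j hκc hκs hκγ hκj
  have hunion : ({c₀, c₁, c₂, c₃} : Set _) = ({c₀, c₁} : Set _) ∪ {c₂, c₃} := by
    ext x; simp only [Set.mem_insert_iff, Set.mem_singleton_iff, Set.mem_union]; tauto
  have hdisj : Disjoint ({c₀, c₁} : Set _) ({c₂, c₃} : Set _) := by
    rw [Set.disjoint_iff_forall_ne]
    rintro x (rfl | rfl) y (rfl | rfl)
    · exact h02
    · exact h03
    · exact h12
    · exact h13
  rw [hS, hunion, finsum_mem_union hdisj (Set.toFinite _) (Set.toFinite _), finsum_mem_pair h01, finsum_mem_pair h23,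
    hκ₀ _ (mk_out_eq c₀), hκ₁ _ (mk_out_eq c₁), hκ₂ _ (mk_out_eq c₂), hκ₃ _ (mk_out_eq c₃)]
  ring

end Generic


/-! ## §3 CM: `κ = κ_v(γ_H, ·)` — the three hypotheses of §2 are ★ §1, ★ `finKappaAt_eq_one_or_eq_neg_one_of_isUnit` and ★ `finKappaAt_conj_eq_iff_normTest` (p840169) -/

section CM

variable (L : Type) [Field L] [NumberField L] [IsCMField L] (v : HeightOneSpectrum (𝓞 ↥(maximalRealSubfield L)))
  (H' : Matrix (Fin 3) (Fin 3) L)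
  (a : (UnitaryGroup.cmDatum L 2 (Matrix.of fun i j : Fin 2 => if i.val + j.val + 1 = 2 then (1 : L) else 0)).Local v ×
      (UnitaryGroup.cmDatum L 1 (Matrix.of fun i j : Fin 1 => if i.val + j.val + 1 = 1 then (1 : L) else 0)).Local v)
  (b : (UnitaryGroup.cmDatum L 3 H').Local v)

/-- **`κ_v` SPLITS THE FOUR CLASSES OF A TYPE-(1) LOCAL STABLE CLASS TWO–TWO: the half with `κ_v(γ_H, ·) = κ_v(γ_H, γ′)`.**  At a finite place
`v` of `L⁺` non-split in `L`, for a matching pair `ι_v(γ_H) ↔ γ′` with `χ_g(u)` a unit and a type-(1) eigenframe `γ′ P = P · diag(u′)` (`u′` injective,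
norm-one entries, `u′_j = u` the `U(1)`-eigenvalue of `γ_H`): among the FOUR classes in the local stable class of `γ′` (★ `ncard_conjClassesIn_eq_four`;
classes of `U(H′_v)(F_v)` = `G′_v`, elements read in `G′_v` as `⟨δ.val, δ.2⟩`) EXACTLY TWO carry the sign `κ_v(γ_H, γ′)` (`κ_v` read on any
representative — a class function, §1) — the kernel of the character `ε ↦ (−1)^{ε_{j_H}}` of `𝓔(T∕F_v) = {ε ∈ (ℤ∕2)³ : Σ ε = 0}`
[Prop. 3.5.2 (c); (4.3.2); Prop. 4.9.1 «`κ` corresponds to `H`»]. [cite: Rogawski1990, §3.5 Prop. 3.5.2 (c) p. 29; §4.3 (4.3.2) p. 43; §4.9 Prop. 4.9.1 p. 55] -/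
theorem ncard_conjClassesIn_sep_finKappaAt_eq_eq_two (w : UnitaryGroup.PlacesOver L v) (hw : IsCMField.complexConj L • w.1 = w.1)
    (h : IsLocalNormPair L H' v a b) (hu : IsUnit ((finCharpolyTwo L v a).eval (finGammaTwo L v a)))
    (hH : (((UnitaryGroup.adelicForm L 3 H').map (UnitaryGroup.adeleToLocal L v)).map
      (UnitaryGroup.conjLocal L (IsCMField.complexConj L) v))ᵀ = (UnitaryGroup.adelicForm L 3 H').map (UnitaryGroup.adeleToLocal L v))
    (hHd : IsUnit ((UnitaryGroup.adelicForm L 3 H').map (UnitaryGroup.adeleToLocal L v)).det)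
    {P : GL (Fin 3) (UnitaryGroup.LocalRing L v)} {u' : Fin 3 → UnitaryGroup.LocalRing L v}
    (hP : (b.val.val : Matrix (Fin 3) (Fin 3) (UnitaryGroup.LocalRing L v)) * P.val = P.val * diagonal u')
    (hu' : Function.Injective u') (hu'1 : ∀ i, UnitaryGroup.conjLocal L (IsCMField.complexConj L) v (u' i) * u' i = 1)
    {j : Fin 3} (hj : u' j = finGammaTwo L v a) :
    {x ∈ conjClassesIn (UnitaryGroup.conjLocal L (IsCMField.complexConj L) v)
          ((UnitaryGroup.adelicForm L 3 H').map (UnitaryGroup.adeleToLocal L v)) ⟨b.val, b.2⟩ |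
        ∀ δ, ConjClasses.mk δ = x → finKappaAt L v H' a ⟨δ.val, δ.2⟩ = finKappaAt L v H' a b}.ncard = 2 := by
  obtain ⟨δ₁, hcδ, hδ⟩ := exists_complexConj_eq_neg_ne_zero L
  exact ncard_conjClassesIn_sep_sign_eq_eq_two L v (IsCMField.complexConj L) hcδ hδ w hw hH hHd b.2 hP hu' hu'1 j
    (κ := fun x => finKappaAt L v H' a ⟨x.val, x.2⟩)
    (fun g hg y hmk => finKappaAt_eq_of_mk_eq_mk L v H' a (isLocalNormPair_of_conj_eq L v H' a b ⟨g * b.val * g⁻¹, hg⟩ h rfl) hmk)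
    (fun g hg => finKappaAt_eq_one_or_eq_neg_one_of_isUnit L v H' a _ (isLocalNormPair_of_conj_eq L v H' a b ⟨g * b.val * g⁻¹, hg⟩ h rfl) hu)
    (finKappaAt_eq_one_or_eq_neg_one_of_isUnit L v H' a b h hu)
    (fun g hg => finKappaAt_conj_eq_iff_normTest L v H' a b ⟨g * b.val * g⁻¹, hg⟩ w hw h hu hH hHd hP hu' hu'1 hj rfl)

/-- **… and the half with the OPPOSITE sign**: exactly two of the four classes carry `κ_v(γ_H, ·) = −κ_v(γ_H, γ′)`.
[cite: Rogawski1990, §3.5 Prop. 3.5.2 (c) p. 29; §4.3 (4.3.2) p. 43; §4.9 Prop. 4.9.1 p. 55] -/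
theorem ncard_conjClassesIn_sep_finKappaAt_eq_neg_two (w : UnitaryGroup.PlacesOver L v) (hw : IsCMField.complexConj L • w.1 = w.1)
    (h : IsLocalNormPair L H' v a b) (hu : IsUnit ((finCharpolyTwo L v a).eval (finGammaTwo L v a)))
    (hH : (((UnitaryGroup.adelicForm L 3 H').map (UnitaryGroup.adeleToLocal L v)).map
      (UnitaryGroup.conjLocal L (IsCMField.complexConj L) v))ᵀ = (UnitaryGroup.adelicForm L 3 H').map (UnitaryGroup.adeleToLocal L v))
    (hHd : IsUnit ((UnitaryGroup.adelicForm L 3 H').map (UnitaryGroup.adeleToLocal L v)).det)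
    {P : GL (Fin 3) (UnitaryGroup.LocalRing L v)} {u' : Fin 3 → UnitaryGroup.LocalRing L v}
    (hP : (b.val.val : Matrix (Fin 3) (Fin 3) (UnitaryGroup.LocalRing L v)) * P.val = P.val * diagonal u')
    (hu' : Function.Injective u') (hu'1 : ∀ i, UnitaryGroup.conjLocal L (IsCMField.complexConj L) v (u' i) * u' i = 1)
    {j : Fin 3} (hj : u' j = finGammaTwo L v a) :
    {x ∈ conjClassesIn (UnitaryGroup.conjLocal L (IsCMField.complexConj L) v)
          ((UnitaryGroup.adelicForm L 3 H').map (UnitaryGroup.adeleToLocal L v)) ⟨b.val, b.2⟩ |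
        ∀ δ, ConjClasses.mk δ = x → finKappaAt L v H' a ⟨δ.val, δ.2⟩ = -finKappaAt L v H' a b}.ncard = 2 := by
  obtain ⟨δ₁, hcδ, hδ⟩ := exists_complexConj_eq_neg_ne_zero L
  exact ncard_conjClassesIn_sep_sign_eq_neg_two L v (IsCMField.complexConj L) hcδ hδ w hw hH hHd b.2 hP hu' hu'1 j
    (κ := fun x => finKappaAt L v H' a ⟨x.val, x.2⟩)
    (fun g hg y hmk => finKappaAt_eq_of_mk_eq_mk L v H' a (isLocalNormPair_of_conj_eq L v H' a b ⟨g * b.val * g⁻¹, hg⟩ h rfl) hmk)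
    (fun g hg => finKappaAt_eq_one_or_eq_neg_one_of_isUnit L v H' a _ (isLocalNormPair_of_conj_eq L v H' a b ⟨g * b.val * g⁻¹, hg⟩ h rfl) hu)
    (finKappaAt_eq_one_or_eq_neg_one_of_isUnit L v H' a b h hu)
    (fun g hg => finKappaAt_conj_eq_iff_normTest L v H' a b ⟨g * b.val * g⁻¹, hg⟩ w hw h hu hH hHd hP hu' hu'1 hj rfl)

/-- **THE `κ_v`-TWISTED COUNT OF THE CLASSES VANISHES** (type (1), non-split `v`): `Σ_{c ⊂ 𝒪_st(γ′)} κ_v(γ_H, out c) = 0` — `κ_v(γ_H, ·)` is a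
NON-TRIVIAL character of the local class set `𝓔(T∕F_v) ≅ (ℤ∕2)²`; so a function of `c` that is CONSTANT on the stable class has vanishing `κ`-orbital sum
(the shape the `Δ`-weighted sum `∑ᶠ c, Δ(γ_H, out c) · Φ(c, 1_K)` of ★ `IsLocalDeltaTransfer` meets on the stable class of `γ′`).
[cite: Rogawski1990, §3.5 Prop. 3.5.2 (c) p. 29; §4.3 (4.3.2) p. 43; §4.9 Prop. 4.9.1 p. 55] -/
theorem finsum_mem_conjClassesIn_finKappaAt_out_eq_zero (w : UnitaryGroup.PlacesOver L v) (hw : IsCMField.complexConj L • w.1 = w.1)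
    (h : IsLocalNormPair L H' v a b) (hu : IsUnit ((finCharpolyTwo L v a).eval (finGammaTwo L v a)))
    (hH : (((UnitaryGroup.adelicForm L 3 H').map (UnitaryGroup.adeleToLocal L v)).map
      (UnitaryGroup.conjLocal L (IsCMField.complexConj L) v))ᵀ = (UnitaryGroup.adelicForm L 3 H').map (UnitaryGroup.adeleToLocal L v))
    (hHd : IsUnit ((UnitaryGroup.adelicForm L 3 H').map (UnitaryGroup.adeleToLocal L v)).det)
    {P : GL (Fin 3) (UnitaryGroup.LocalRing L v)} {u' : Fin 3 → UnitaryGroup.LocalRing L v}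
    (hP : (b.val.val : Matrix (Fin 3) (Fin 3) (UnitaryGroup.LocalRing L v)) * P.val = P.val * diagonal u')
    (hu' : Function.Injective u') (hu'1 : ∀ i, UnitaryGroup.conjLocal L (IsCMField.complexConj L) v (u' i) * u' i = 1)
    {j : Fin 3} (hj : u' j = finGammaTwo L v a) :
    ∑ᶠ x ∈ conjClassesIn (UnitaryGroup.conjLocal L (IsCMField.complexConj L) v)
          ((UnitaryGroup.adelicForm L 3 H').map (UnitaryGroup.adeleToLocal L v)) ⟨b.val, b.2⟩,
        finKappaAt L v H' a ⟨(Quotient.out x).val, (Quotient.out x).2⟩ = 0 := by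
  obtain ⟨δ₁, hcδ, hδ⟩ := exists_complexConj_eq_neg_ne_zero L
  exact finsum_mem_conjClassesIn_sign_out_eq_zero L v (IsCMField.complexConj L) hcδ hδ w hw hH hHd b.2 hP hu' hu'1 j
    (κ := fun x => finKappaAt L v H' a ⟨x.val, x.2⟩)
    (fun g hg y hmk => finKappaAt_eq_of_mk_eq_mk L v H' a (isLocalNormPair_of_conj_eq L v H' a b ⟨g * b.val * g⁻¹, hg⟩ h rfl) hmk)
    (fun g hg => finKappaAt_eq_one_or_eq_neg_one_of_isUnit L v H' a _ (isLocalNormPair_of_conj_eq L v H' a b ⟨g * b.val * g⁻¹, hg⟩ h rfl) hu)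
    (finKappaAt_eq_one_or_eq_neg_one_of_isUnit L v H' a b h hu)
    (fun g hg => finKappaAt_conj_eq_iff_normTest L v H' a b ⟨g * b.val * g⁻¹, hg⟩ w hw h hu hH hHd hP hu' hu'1 hj rfl)

end CM

end Literature.NumberTheory.Rogawski1990
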